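import Mathlib
import Literature.NumberTheory.Transcendental.KZLogCalculusProofs
import Literature.ModelTheory.ExponentialFields.TarskiSeidenbergProofs
import Literature.Barriers.KontsevichZagierPeriods.PeriodEqualityDecidability
import Literature.Barriers.KontsevichZagierPeriods.AlgebraicPrimitivesObstruction
import Summits.KontsevichZagierPeriods.KontsevichZagierPeriods.Theses.LiouvilleUnfolding

/-!
# drefute — stub set of line `engine-transport` (crux `UnfoldedLogStokes`, stmt-KontsevichZagierPeriods-2835)

Registered skeleton `9328557fb75a` (lead `prover-line-stmt-KontsevichZagierPeriods-2835-0`), stubs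
`stub_foldIntegrable`, `stub_velocityExtension`, `stub_nullNormalise` — copied VERBATIM from the ledger
(§0).  All three are TRUE (kernel-checked in the companion file `Verify2.lean` =
`Cruxes/UnfoldedLogStokes/SketchIdeator2.lean` + the registered signatures closed by
`defoldIntegrable_holds` / `velocityExtension_holds` / `nullNormalise_holds`; rc 0, 0 sorries, axioms
propext / Classical.choice / Quot.sound).  This file records the HYPOTHESIS MUTATION pass:

* §1 redundant hypotheses (derivable from the others): the base-set semialgebraicity `hσ` / `hτ` of
  `stub_foldIntegrable` / `stub_velocityExtension` (projection of a semialgebraic graph, Tarski–Seidenberg,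
  `tarski_seidenberg_real_holds`), and `IsSemialgebraic ℚ N` of `stub_nullNormalise` (replace `N` by the
  semialgebraic disagreement set) — the N-free / σ-free forms FOLLOW from the registered stubs;
* §2 load-bearing hypotheses: one-clause deletions that are FALSE, each with an honest witness in the
  smallest dimension (`n = 0` constants `constRep`, or `n = 1` where `vol ℝ¹ = ∞`), refuted through the
  only invariant of `KZ.relations`, soundness `KZ.relations_le_ker_eval_holds`, or through plain
  non-integrability of a non-zero constant on `ℝ¹`; `stub_velocityExtension` without the semialgebraicity
  of `F` is killed by the catalogued barrier
  `Literature.Barriers.KontsevichZagierPeriods.KZ.noSemialgebraicPrimitive_inv_sub_two` (witness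
  `F = (2−t)(1 − log(2−t))`, `∂ₜF = log(2−t)`, a primitive of `1/(t−2)`).
-/

noncomputable section

set_option linter.dupNamespace false

open Set MeasureTheory
open Literature.NumberTheory.Transcendental
open Literature.ModelTheory.ExponentialFields (IsSemialgebraic isSemialgebraic_univ isSemialgebraic_empty
  tarski_seidenberg_real_holds)

namespace Summit.KontsevichZagierPeriods.KontsevichZagierPeriods.Cruxes.UnfoldedLogStokes.Drefute

/-! ## §0 The registered stubs, verbatim (ledger `workitem get stmt-KontsevichZagierPeriods-2835`, skeleton 9328557fb75a) -/

/-- Registered stub `stub_foldIntegrable` (verbatim). -/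
def Stub_foldIntegrable : Prop :=
  ∀ (n : ℕ) (σ N : Set (Fin n → ℝ)) (h v : (Fin n → ℝ) → ℝ) (g : (Fin (n + 1) → ℝ) → ℝ), Literature.ModelTheory.ExponentialFields.IsSemialgebraic ℚ σ → Literature.NumberTheory.Transcendental.IsSemialgebraicFunOn ℚ σ h → Literature.NumberTheory.Transcendental.IsSemialgebraicFunOn ℚ σ v → (∀ x ∈ σ, 1 ≤ v x) → MeasureTheory.volume N = 0 → MeasureTheory.IntegrableOn g (Literature.NumberTheory.Transcendental.KZlog.band σ (fun _ => 1) v) → (∀ z ∈ Literature.NumberTheory.Transcendental.KZlog.band σ (fun _ => 1) v, Fin.init z ∉ N → g z = h (Fin.init z) / z (Fin.last n)) → MeasureTheory.IntegrableOn (fun x => h x * Real.log (v x)) σ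

/-- Registered stub `stub_velocityExtension` (verbatim). -/
def Stub_velocityExtension : Prop :=
  ∀ (n : ℕ) (τ : Set (Fin n → ℝ)) (a b : (Fin n → ℝ) → ℝ) (F F' : (Fin (n + 1) → ℝ) → ℝ), Literature.ModelTheory.ExponentialFields.IsSemialgebraic ℚ τ → Literature.NumberTheory.Transcendental.IsSemialgebraicFunOn ℚ τ a → Literature.NumberTheory.Transcendental.IsSemialgebraicFunOn ℚ τ b → Literature.NumberTheory.Transcendental.IsSemialgebraicFunOn ℚ (Literature.NumberTheory.Transcendental.KZlog.band τ a b) F → (∀ x ∈ τ, ∀ t ∈ Set.Ioo (a x) (b x), HasDerivAt (fun s : ℝ => F (Fin.snoc x s)) (F' (Fin.snoc x t)) t) → ∃ F'' : (Fin (n + 1) → ℝ) → ℝ, Literature.NumberTheory.Transcendental.IsSemialgebraicFunOn ℚ (Literature.NumberTheory.Transcendental.KZlog.band τ a b) F'' ∧ ∀ x ∈ τ, ∀ t ∈ Set.Ioo (a x) (b x), HasDerivAt (fun s : ℝ => F (Fin.snoc x s)) (F'' (Fin.snoc x t)) t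

/-- Registered stub `stub_nullNormalise` (verbatim). -/
def Stub_nullNormalise : Prop :=
  ∀ (n : ℕ) (r r' : Literature.NumberTheory.Transcendental.KZ.IntegralRep n) (N : Set (Fin n → ℝ)), r'.domain = r.domain → Literature.ModelTheory.ExponentialFields.IsSemialgebraic ℚ N → MeasureTheory.volume N = 0 → Set.EqOn r.integrand r'.integrand (r.domain \ N) → Literature.NumberTheory.Transcendental.KZ.of r - Literature.NumberTheory.Transcendental.KZ.of r' ∈ Literature.NumberTheory.Transcendental.KZ.relations

/-! ## §1 Redundant hypotheses (the deleted clause is DERIVABLE; the weaker-looking forms follow from the registered stubs) -/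

/-- The base of a `ℚ`-semialgebraic function is `ℚ`-semialgebraic: it is the projection of the graph
(Tarski–Seidenberg, `tarski_seidenberg_real_holds`). Hence `hσ` of `stub_foldIntegrable` and `hτ` of
`stub_velocityExtension` are derivable from `hh` resp. `ha`. -/
theorem isSemialgebraic_of_isSemialgebraicFunOn {m : ℕ} {s : Set (Fin m → ℝ)} {f : (Fin m → ℝ) → ℝ}
    (hf : IsSemialgebraicFunOn ℚ s f) : IsSemialgebraic ℚ s := by
  have h := tarski_seidenberg_real_holds (k := ℚ) (isSemialgebraicFunOn_iff.mp hf)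
  convert h using 1
  ext x
  simp only [mem_image, mem_setOf_eq]
  constructor
  · intro hx
    refine ⟨Fin.snoc x (f x), ⟨by simpa using hx, by simp⟩, ?_⟩
    funext i
    simp
  · rintro ⟨z, ⟨hz, -⟩, rfl⟩
    exact hz

/-- The agreement set of two `ℚ`-semialgebraic functions on `s` is `ℚ`-semialgebraic (projection of
the intersection of the two graphs). -/
theorem isSemialgebraic_setOf_eq {m : ℕ} {s : Set (Fin m → ℝ)} {f g : (Fin m → ℝ) → ℝ}
    (hf : IsSemialgebraicFunOn ℚ s f) (hg : IsSemialgebraicFunOn ℚ s g) :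
    IsSemialgebraic ℚ {x | x ∈ s ∧ f x = g x} := by
  have h := tarski_seidenberg_real_holds (k := ℚ)
    ((isSemialgebraicFunOn_iff.mp hf).inter (isSemialgebraicFunOn_iff.mp hg))
  convert h using 1
  ext x
  simp only [mem_image, mem_setOf_eq, mem_inter_iff]
  constructor
  · rintro ⟨hx, hfg⟩
    refine ⟨Fin.snoc x (f x), ⟨⟨by simpa using hx, by simp⟩, ⟨by simpa using hx, by simp [hfg]⟩⟩, ?_⟩
    funext i
    simp
  · rintro ⟨z, ⟨⟨hz, hzf⟩, ⟨-, hzg⟩⟩, rfl⟩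
    exact ⟨hz, hzf.symm.trans hzg⟩

/-- `stub_foldIntegrable` with the clause `IsSemialgebraic ℚ σ` DELETED follows from the registered stub. -/
theorem foldIntegrable_without_hσ (H : Stub_foldIntegrable) :
    ∀ (n : ℕ) (σ N : Set (Fin n → ℝ)) (h v : (Fin n → ℝ) → ℝ) (g : (Fin (n + 1) → ℝ) → ℝ),
      IsSemialgebraicFunOn ℚ σ h → IsSemialgebraicFunOn ℚ σ v → (∀ x ∈ σ, 1 ≤ v x) → volume N = 0 →
      IntegrableOn g (KZlog.band σ (fun _ => 1) v) →
      (∀ z ∈ KZlog.band σ (fun _ => 1) v, Fin.init z ∉ N → g z = h (Fin.init z) / z (Fin.last n)) →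
      IntegrableOn (fun x => h x * Real.log (v x)) σ :=
  fun n σ N h v g hh hv => H n σ N h v g (isSemialgebraic_of_isSemialgebraicFunOn hh) hh hv

/-- `stub_velocityExtension` with the clause `IsSemialgebraic ℚ τ` DELETED follows from the registered
stub. -/
theorem velocityExtension_without_hτ (H : Stub_velocityExtension) :
    ∀ (n : ℕ) (τ : Set (Fin n → ℝ)) (a b : (Fin n → ℝ) → ℝ) (F F' : (Fin (n + 1) → ℝ) → ℝ),
      IsSemialgebraicFunOn ℚ τ a → IsSemialgebraicFunOn ℚ τ b →
      IsSemialgebraicFunOn ℚ (KZlog.band τ a b) F →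
      (∀ x ∈ τ, ∀ t ∈ Ioo (a x) (b x),
        HasDerivAt (fun s : ℝ => F (Fin.snoc x s)) (F' (Fin.snoc x t)) t) →
      ∃ F'' : (Fin (n + 1) → ℝ) → ℝ, IsSemialgebraicFunOn ℚ (KZlog.band τ a b) F'' ∧
        ∀ x ∈ τ, ∀ t ∈ Ioo (a x) (b x),
          HasDerivAt (fun s : ℝ => F (Fin.snoc x s)) (F'' (Fin.snoc x t)) t :=
  fun n τ a b F F' ha => H n τ a b F F' (isSemialgebraic_of_isSemialgebraicFunOn ha) ha

/-- `stub_nullNormalise` with the clause `IsSemialgebraic ℚ N` DELETED follows from the registered stub: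
shrink `N` to the disagreement set `r.domain \ {x ∈ r.domain | r.integrand x = r'.integrand x} ⊆ N`,
which is `ℚ`-semialgebraic because both integrands are. -/
theorem nullNormalise_without_hN (H : Stub_nullNormalise) :
    ∀ (n : ℕ) (r r' : KZ.IntegralRep n) (N : Set (Fin n → ℝ)), r'.domain = r.domain → volume N = 0 →
      EqOn r.integrand r'.integrand (r.domain \ N) → KZ.of r - KZ.of r' ∈ KZ.relations := by
  intro n r r' N hd hN0 heq
  set A : Set (Fin n → ℝ) := {x | x ∈ r.domain ∧ r.integrand x = r'.integrand x} with hA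
  have hg : IsSemialgebraicFunOn ℚ r.domain r'.integrand := by
    rw [← hd]; exact r'.isSemialgebraicFunOn_integrand
  have hsa : IsSemialgebraic ℚ (r.domain \ A) :=
    r.isSemialgebraic_domain.diff (isSemialgebraic_setOf_eq r.isSemialgebraicFunOn_integrand hg)
  have hsub : r.domain \ A ⊆ N := by
    intro x hx
    by_contra hxN
    exact hx.2 ⟨hx.1, heq ⟨hx.1, hxN⟩⟩
  refine H n r r' (r.domain \ A) hd hsa (measure_mono_null hsub hN0) ?_
  intro x hx
  have hxA : x ∈ A := by
    by_contra hxA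
    exact hx.2 ⟨hx.1, hxA⟩
  exact hxA.2

/-! ## §2 Load-bearing hypotheses (one-clause deletions that are FALSE, with honest witnesses) -/

open Literature.Barriers.KontsevichZagierPeriods.KZ (constRep constRep_value
  noSemialgebraicPrimitive_inv_sub_two_holds)

/-- Soundness of the calculus in the two-term shape: related representations have equal values
(`KZ.relations_le_ker_eval_holds`). -/
theorem value_eq_of_sub_mem {n : ℕ} {r r' : KZ.IntegralRep n}
    (h : KZ.of r - KZ.of r' ∈ KZ.relations) : r.value = r'.value := by
  have := KZ.relations_le_ker_eval_holds h
  rwa [AddMonoidHom.mem_ker, map_sub, KZ.eval_of, KZ.eval_of, sub_eq_zero] at this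

/-- `stub_nullNormalise` with `volume N = 0` deleted. -/
def NullNormaliseWithoutNull : Prop :=
  ∀ (n : ℕ) (r r' : KZ.IntegralRep n) (N : Set (Fin n → ℝ)), r'.domain = r.domain →
    IsSemialgebraic ℚ N → EqOn r.integrand r'.integrand (r.domain \ N) →
    KZ.of r - KZ.of r' ∈ KZ.relations

/-- FALSE: witness `n = 0`, `r = [pt, 1]`, `r' = [pt, −1]`, `N = pt` (values `1 ≠ −1`). -/
theorem not_nullNormaliseWithoutNull : ¬ NullNormaliseWithoutNull := by
  intro H
  have h := H 0 (constRep 1) (constRep 1).neg univ (KZ.IntegralRep.domain_neg _) isSemialgebraic_univ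
    (by simp)
  have := value_eq_of_sub_mem h
  rw [KZ.IntegralRep.value_neg, constRep_value] at this
  norm_num at this

/-- `stub_nullNormalise` with `r'.domain = r.domain` deleted. -/
def NullNormaliseWithoutDomain : Prop :=
  ∀ (n : ℕ) (r r' : KZ.IntegralRep n) (N : Set (Fin n → ℝ)), IsSemialgebraic ℚ N → volume N = 0 →
    EqOn r.integrand r'.integrand (r.domain \ N) → KZ.of r - KZ.of r' ∈ KZ.relations

/-- FALSE: witness `n = 0`, `r = [pt, 1]`, `r' = [∅, 1]`, `N = ∅` (values `1 ≠ 0`). -/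
theorem not_nullNormaliseWithoutDomain : ¬ NullNormaliseWithoutDomain := by
  intro H
  have h := H 0 (constRep 1) ((constRep 1).restrict ∅ isSemialgebraic_empty (empty_subset _)) ∅
    isSemialgebraic_empty (by simp) (fun _ _ => rfl)
  have := value_eq_of_sub_mem h
  rw [constRep_value] at this
  simp [KZ.IntegralRep.value] at this

/-- `vol(ℝ¹) = ∞`. -/
theorem volume_univ_fin_one : volume (univ : Set (Fin 1 → ℝ)) = ⊤ := by
  rw [volume_pi, Measure.pi_univ]
  simp

/-- A non-zero constant is not integrable on `ℝ¹`. -/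
theorem not_integrableOn_const_univ_fin_one {c : ℝ} (hc : c ≠ 0) :
    ¬ IntegrableOn (fun _ : Fin 1 → ℝ => c) univ := by
  rw [integrableOn_const_iff]
  simp [hc]

theorem sa_one₁ : IsSemialgebraicFunOn ℚ (univ : Set (Fin 1 → ℝ)) (fun _ => (1 : ℝ)) := by
  simpa using isSemialgebraicFunOn_ratCast isSemialgebraic_univ 1

theorem sa_two₁ : IsSemialgebraicFunOn ℚ (univ : Set (Fin 1 → ℝ)) (fun _ => (2 : ℝ)) := by
  simpa using isSemialgebraicFunOn_ratCast isSemialgebraic_univ 2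

theorem sa_half₁ : IsSemialgebraicFunOn ℚ (univ : Set (Fin 1 → ℝ)) (fun _ => (2 : ℝ)⁻¹) := by
  simpa using isSemialgebraicFunOn_ratCast isSemialgebraic_univ 2⁻¹

theorem log_two_ne : (1 : ℝ) * Real.log 2 ≠ 0 := by
  rw [one_mul]; exact (Real.log_pos one_lt_two).ne'

/-- `stub_foldIntegrable` with `∀ x ∈ σ, 1 ≤ v x` deleted. -/
def FoldIntegrableWithoutVGeOne : Prop :=
  ∀ (n : ℕ) (σ N : Set (Fin n → ℝ)) (h v : (Fin n → ℝ) → ℝ) (g : (Fin (n + 1) → ℝ) → ℝ),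
    IsSemialgebraic ℚ σ → IsSemialgebraicFunOn ℚ σ h → IsSemialgebraicFunOn ℚ σ v → volume N = 0 →
    IntegrableOn g (KZlog.band σ (fun _ => 1) v) →
    (∀ z ∈ KZlog.band σ (fun _ => 1) v, Fin.init z ∉ N → g z = h (Fin.init z) / z (Fin.last n)) →
    IntegrableOn (fun x => h x * Real.log (v x)) σ

/-- FALSE: witness `n = 1`, `σ = ℝ¹`, `h = 1`, `v = 1/2` (empty band, every `g` qualifies),
`h·log v = −log 2 ∉ L¹(ℝ¹)`.  (`1 ≤ v` cannot even be weakened to `0 < v`.) -/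
theorem not_foldIntegrableWithoutVGeOne : ¬ FoldIntegrableWithoutVGeOne := by
  intro H
  have hband : KZlog.band (univ : Set (Fin 1 → ℝ)) (fun _ => (1 : ℝ)) (fun _ => (2 : ℝ)⁻¹) = ∅ := by
    ext z
    simp only [KZlog.mem_band, mem_univ, true_and, mem_empty_iff_false, iff_false, not_and, not_le]
    intro h1
    have : (2 : ℝ)⁻¹ < 1 := by norm_num
    linarith
  have h := H 1 univ ∅ (fun _ => 1) (fun _ => (2 : ℝ)⁻¹) (fun _ => 0) isSemialgebraic_univ sa_one₁
    sa_half₁ (by simp) (by rw [hband]; exact integrableOn_empty)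
    (by intro z hz; rw [hband] at hz; exact absurd hz (notMem_empty _))
  have hc : (1 : ℝ) * Real.log ((2 : ℝ)⁻¹) ≠ 0 := by
    rw [one_mul, Real.log_inv]; exact neg_ne_zero.mpr (Real.log_pos one_lt_two).ne'
  exact not_integrableOn_const_univ_fin_one hc h

/-- `stub_foldIntegrable` with `volume N = 0` deleted. -/
def FoldIntegrableWithoutNull : Prop :=
  ∀ (n : ℕ) (σ N : Set (Fin n → ℝ)) (h v : (Fin n → ℝ) → ℝ) (g : (Fin (n + 1) → ℝ) → ℝ),
    IsSemialgebraic ℚ σ → IsSemialgebraicFunOn ℚ σ h → IsSemialgebraicFunOn ℚ σ v →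
    (∀ x ∈ σ, 1 ≤ v x) →
    IntegrableOn g (KZlog.band σ (fun _ => 1) v) →
    (∀ z ∈ KZlog.band σ (fun _ => 1) v, Fin.init z ∉ N → g z = h (Fin.init z) / z (Fin.last n)) →
    IntegrableOn (fun x => h x * Real.log (v x)) σ

/-- FALSE: witness `n = 1`, `σ = N = ℝ¹`, `h = 1`, `v = 2`, `g = 0` (pinning vacuous off `N`). -/
theorem not_foldIntegrableWithoutNull : ¬ FoldIntegrableWithoutNull := by
  intro H
  have h := H 1 univ univ (fun _ => 1) (fun _ => 2) (fun _ => 0) isSemialgebraic_univ sa_one₁ sa_two₁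
    (fun _ _ => by norm_num) integrableOn_zero (fun z _ hN => absurd (mem_univ _) hN)
  exact not_integrableOn_const_univ_fin_one log_two_ne h

/-- `stub_foldIntegrable` with `IntegrableOn g (band)` deleted. -/
def FoldIntegrableWithoutIntegrable : Prop :=
  ∀ (n : ℕ) (σ N : Set (Fin n → ℝ)) (h v : (Fin n → ℝ) → ℝ) (g : (Fin (n + 1) → ℝ) → ℝ),
    IsSemialgebraic ℚ σ → IsSemialgebraicFunOn ℚ σ h → IsSemialgebraicFunOn ℚ σ v →
    (∀ x ∈ σ, 1 ≤ v x) → volume N = 0 →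
    (∀ z ∈ KZlog.band σ (fun _ => 1) v, Fin.init z ∉ N → g z = h (Fin.init z) / z (Fin.last n)) →
    IntegrableOn (fun x => h x * Real.log (v x)) σ

/-- FALSE: witness `n = 1`, `σ = ℝ¹`, `N = ∅`, `h = 1`, `v = 2`, `g = 1/u` (honestly pinned). -/
theorem not_foldIntegrableWithoutIntegrable : ¬ FoldIntegrableWithoutIntegrable := by
  intro H
  have h := H 1 univ ∅ (fun _ => 1) (fun _ => 2) (fun z => 1 / z (Fin.last 1)) isSemialgebraic_univ
    sa_one₁ sa_two₁ (fun _ _ => by norm_num) (by simp) (fun z _ _ => rfl)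
  exact not_integrableOn_const_univ_fin_one log_two_ne h

/-- `stub_foldIntegrable` with the pinning clause deleted. -/
def FoldIntegrableWithoutPin : Prop :=
  ∀ (n : ℕ) (σ N : Set (Fin n → ℝ)) (h v : (Fin n → ℝ) → ℝ) (g : (Fin (n + 1) → ℝ) → ℝ),
    IsSemialgebraic ℚ σ → IsSemialgebraicFunOn ℚ σ h → IsSemialgebraicFunOn ℚ σ v →
    (∀ x ∈ σ, 1 ≤ v x) → volume N = 0 →
    IntegrableOn g (KZlog.band σ (fun _ => 1) v) →
    IntegrableOn (fun x => h x * Real.log (v x)) σ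

/-- FALSE: witness `n = 1`, `σ = ℝ¹`, `N = ∅`, `h = 1`, `v = 2`, `g = 0`. -/
theorem not_foldIntegrableWithoutPin : ¬ FoldIntegrableWithoutPin := by
  intro H
  have h := H 1 univ ∅ (fun _ => 1) (fun _ => 2) (fun _ => 0) isSemialgebraic_univ sa_one₁ sa_two₁
    (fun _ _ => by norm_num) (by simp) integrableOn_zero
  exact not_integrableOn_const_univ_fin_one log_two_ne h

/-- `stub_velocityExtension` with the clause `IsSemialgebraicFunOn ℚ (band) F` DELETED. -/
def VelocityExtensionWithoutF : Prop :=
  ∀ (n : ℕ) (τ : Set (Fin n → ℝ)) (a b : (Fin n → ℝ) → ℝ) (F F' : (Fin (n + 1) → ℝ) → ℝ),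
    IsSemialgebraic ℚ τ → IsSemialgebraicFunOn ℚ τ a → IsSemialgebraicFunOn ℚ τ b →
    (∀ x ∈ τ, ∀ t ∈ Ioo (a x) (b x),
      HasDerivAt (fun s : ℝ => F (Fin.snoc x s)) (F' (Fin.snoc x t)) t) →
    ∃ F'' : (Fin (n + 1) → ℝ) → ℝ, IsSemialgebraicFunOn ℚ (KZlog.band τ a b) F'' ∧
      ∀ x ∈ τ, ∀ t ∈ Ioo (a x) (b x),
        HasDerivAt (fun s : ℝ => F (Fin.snoc x s)) (F'' (Fin.snoc x t)) t

/-- The witness primitive `Λ t = (2 − t)(1 − log (2 − t))` has `Λ' = log (2 − t)` for `t < 2`. -/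
theorem hasDerivAt_Λ {t : ℝ} (ht : t < 2) :
    HasDerivAt (fun s : ℝ => (2 - s) * (1 - Real.log (2 - s))) (Real.log (2 - t)) t := by
  have h2 : (2 : ℝ) - t ≠ 0 := by linarith
  have hu : HasDerivAt (fun s : ℝ => 2 - s) (-1) t := (hasDerivAt_id t).const_sub 2
  have hlog : HasDerivAt (fun s : ℝ => Real.log (2 - s)) ((-1) / (2 - t)) t := hu.log h2
  have hv : HasDerivAt (fun s : ℝ => 1 - Real.log (2 - s)) (-((-1) / (2 - t))) t := hlog.const_sub 1
  have h' : HasDerivAt (fun s : ℝ => (2 - s) * (1 - Real.log (2 - s)))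
      (-1 * (1 - Real.log (2 - t)) + (2 - t) * -((-1) / (2 - t))) t := hu.mul hv
  refine h'.congr_deriv ?_
  rw [neg_div, neg_neg, mul_one_div_cancel h2]
  ring

/-- `log (2 − t)` is a primitive of `1/(t − 2)` on `t < 2`. -/
theorem hasDerivAt_log_two_sub {t : ℝ} (ht : t < 2) :
    HasDerivAt (fun s : ℝ => Real.log (2 - s)) (1 / (t - 2)) t := by
  have h2 : (2 : ℝ) - t ≠ 0 := by linarith
  have hlog : HasDerivAt (fun s : ℝ => Real.log (2 - s)) ((-1) / (2 - t)) t :=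
    ((hasDerivAt_id t).const_sub 2).log h2
  convert hlog using 1
  rw [neg_div, ← div_neg, neg_sub]

/-- Witness function `F(z) = Λ(z₀)`, `Λ t = (2 − t)(1 − log(2 − t))`, over the one-point base. -/
def Fw : (Fin 1 → ℝ) → ℝ := fun z => (2 - z (Fin.last 0)) * (1 - Real.log (2 - z (Fin.last 0)))

/-- Its fibre velocity `F'(z) = log (2 − z₀)` (NOT semialgebraic). -/
def Fw' : (Fin 1 → ℝ) → ℝ := fun z => Real.log (2 - z (Fin.last 0))

@[simp] theorem Fw_snoc (x : Fin 0 → ℝ) (s : ℝ) :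
    Fw (Fin.snoc x s) = (2 - s) * (1 - Real.log (2 - s)) := by simp only [Fw, Fin.snoc_last]

@[simp] theorem Fw'_snoc (x : Fin 0 → ℝ) (s : ℝ) : Fw' (Fin.snoc x s) = Real.log (2 - s) := by
  simp only [Fw', Fin.snoc_last]

/-- FALSE — killed by the catalogued barrier `noSemialgebraicPrimitive_inv_sub_two` (PROVED in tree):
witness `n = 0`, band `[0, 1]`, `F = Λ(t) = (2 − t)(1 − log(2 − t))` (any `F` qualifies once its
semialgebraicity is not asked), `F' = log (2 − t)`; a semialgebraic velocity `F''` would agree with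
`log (2 − t)` on `(0, 1)` (uniqueness of derivatives) and hence be a `ℚ`-semialgebraic primitive of
`1/(t − 2)` on `[0, 1]`, which the barrier forbids.  So BPR Prop. 3.22 (`hF`) is genuinely used. -/
theorem not_velocityExtensionWithoutF : ¬ VelocityExtensionWithoutF := by
  intro H
  set x₀ : Fin 0 → ℝ := Fin.elim0 with hx₀
  have hsnoc : ∀ s : ℝ, (Fin.snoc x₀ s : Fin 1 → ℝ) = fun _ => s := by
    intro s
    funext i
    have hi : i = Fin.last 0 := by
      apply Fin.ext
      have h := i.isLt
      rw [Fin.val_last]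
      omega
    subst hi
    exact Fin.snoc_last _ _
  have hder : ∀ x ∈ (univ : Set (Fin 0 → ℝ)), ∀ t ∈ Ioo (0 : ℝ) 1,
      HasDerivAt (fun s : ℝ => Fw (Fin.snoc x s)) (Fw' (Fin.snoc x t)) t := by
    intro x _ t ht
    simp only [Fw_snoc, Fw'_snoc]
    exact hasDerivAt_Λ (by linarith [ht.2])
  obtain ⟨F'', hsa, hF''⟩ := H 0 univ (fun _ => 0) (fun _ => 1) Fw Fw' isSemialgebraic_univ
    (by simpa using isSemialgebraicFunOn_ratCast isSemialgebraic_univ 0)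
    (by simpa using isSemialgebraicFunOn_ratCast isSemialgebraic_univ 1) hder
  -- on the open interval the velocity IS `log (2 − t)` (uniqueness of derivatives)
  have key : ∀ t ∈ Ioo (0 : ℝ) 1, F'' (fun _ => t) = Real.log (2 - t) := by
    intro t ht
    have h1 := hF'' x₀ (mem_univ _) t ht
    simp only [Fw_snoc] at h1
    have h2 : HasDerivAt (fun s : ℝ => (2 - s) * (1 - Real.log (2 - s))) (Real.log (2 - t)) t :=
      hasDerivAt_Λ (by linarith [ht.2])
    rw [← hsnoc t]
    exact h1.unique h2
  -- the band over the point is `[0, 1] ⊆ ℝ¹`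
  have hband : KZlog.band (univ : Set (Fin 0 → ℝ)) (fun _ => (0 : ℝ)) (fun _ => (1 : ℝ)) =
      {x : Fin 1 → ℝ | x 0 ∈ Icc (0 : ℝ) 1} := by
    ext z
    simp [KZlog.mem_band]
  refine noSemialgebraicPrimitive_inv_sub_two_holds ⟨F'', hband ▸ hsa, fun t ht => ?_⟩
  have hev : (fun s : ℝ => F'' (fun _ => s)) =ᶠ[nhds t] fun s => Real.log (2 - s) :=
    Filter.eventuallyEq_of_mem (Ioo_mem_nhds ht.1 ht.2) fun s hs => key s hs
  exact (hasDerivAt_log_two_sub (by linarith [ht.2])).congr_of_eventuallyEq hev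

end Summit.KontsevichZagierPeriods.KontsevichZagierPeriods.Cruxes.UnfoldedLogStokes.Drefute
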